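import Literature.Topology.FourManifolds.OneManifoldOrientable
import Mathlib.Data.Nat.Pairing
import HarnessLib

/-!
# Every connected `1`-manifold is covered by a compatible family of arc charts, hence orientable

Topic `Literature/Topology/FourManifolds`, sequel to `OneManifoldTwoCharts.lean` and
`OneManifoldOrientable.lean`, which treat the *compact* connected case of Milnor's
classification of one-manifolds (*Topology from the Differentiable Viewpoint* (1965), Appendix
"Classifying 1-manifolds", pp. 55–57): a compact connected Hausdorff `1`-manifold is covered by
two compatible arc charts and is therefore orientable. This file removes the compactness
hypothesis:

* `OneManifold.nonempty_smoothOrientation_of_compatible_family`: an indexed family of real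
  charts covering the `C¹` manifold `M` (modelled on `ℝ¹`) and inducing pairwise the same local
  order on overlaps orients `M` (the two-chart lemma
  `OneManifold.nonempty_smoothOrientation_of_compatible_arcCharts` verbatim, the reference chart
  at a point being any member of the family containing it);
* `OneManifold.exists_compatible_arcCharts_nat` (**Milnor's maximality argument, general
  case**): a connected Hausdorff second countable locally connected space in which every point
  lies in an arc chart is covered by a sequence of arc charts inducing pairwise the same local
  order on overlaps. Milnor (p. 56–57) takes a parametrization by arc-length which is maximal
  and shows that, unless `M` is a circle, it is onto. Without arc-length we run the equivalent
  countable recursion: fix a countable cover by arc charts `c₀, c₁, …`; at stage `n` the current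
  arc `gₙ` absorbs the chart `c_k`, `k = (Nat.unpair n).1` (so that every index recurs
  infinitely often), by Milnor's Lemma (`OneManifold.union_or_cover`) whenever the two overlap —
  unless the Lemma produces a cover of `M` by two compatible arc charts, in which case we are
  done at once — and the new arc is reflected if necessary so that the transition from `gₙ` is
  increasing. The union of the arcs `gₙ` is open and closed (a chart `c_k` through a boundary
  point meets some `gₙ`, hence is absorbed at the next stage `n' ≥ n` with `(Nat.unpair n').1 = k`),
  hence all of `M`; the transitions `g_n ∘ g_m⁻¹`, `m ≤ n`, are increasing as composites of
  increasing maps;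
* `OneManifold.isOrientable_of_connectedSpace` (**every connected Hausdorff second countable
  `1`-manifold is orientable**), superseding
  `OneManifold.isOrientable_of_compactSpace_of_connectedSpace`.

All statements are **proved**; no definitions or named facts are introduced.

## References

* J. Milnor, *Topology from the Differentiable Viewpoint*, Univ. Press of Virginia (1965),
  Appendix "Classifying 1-manifolds", Lemma and Theorem pp. 55–57. [MilnorTDV1965]
* M. W. Hirsch, *Differential Topology*, GTM 33 (1976), Ch. 1 §2 Exercise 6; §4.4.
  [HirschDT1976]
-/

open Set Filter Topology Module
open scoped Manifold ContDiff

noncomputable section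

namespace Literature.Topology.FourManifolds

namespace OneManifold

/-! ### Orientation from a compatible family of real charts -/

section Family

variable {M : Type*} [TopologicalSpace M] [ChartedSpace (EuclideanSpace ℝ (Fin 1)) M]
  [IsManifold (𝓡 1) 1 M]

/-- **A compatible family of real charts covering a `1`-manifold orients it.** Let
`g i : M ⇀ ℝ`, `i : ι`, be open partial homeomorphisms whose sources cover the `C¹` manifold `M`
(modelled on `ℝ¹`) and which induce pairwise the same local order at every point of the overlap
of their sources (`g i q < g i p ↔ g j q < g j p` and `g i p < g i q ↔ g j p < g j q` for `q`
near `p`). Then `M` carries a `SmoothOrientation (𝓡 1)`: orient the tangent line at `y`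
positively iff the coordinate of the preferred chart at `y` has, near `y`, the same direction as
a member of the family containing `y` (by compatibility the choice is immaterial); the defining
local constancy of a smooth orientation is then the sign rule for directions
(`same_iff_same_iff`) and the dictionary "same direction ↔ positive Jacobian"
(`same_coord_iff_det_pos`), exactly as in the two-chart case
`nonempty_smoothOrientation_of_compatible_arcCharts`. Orientations as signs of Jacobians:
Hirsch, *Differential Topology* (1976), §4.4. [cite: HirschDT1976, §4.4] -/
theorem nonempty_smoothOrientation_of_compatible_family {ι : Type*}
    (g : ι → OpenPartialHomeomorph M ℝ) (hcov : ⋃ i, (g i).source = univ)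
    (hcompat : ∀ i j, ∀ p ∈ (g i).source ∩ (g j).source, ∀ᶠ q in 𝓝 p,
      (g i q < g i p ↔ g j q < g j p) ∧ (g i p < g i q ↔ g j p < g j q)) :
    Nonempty (SmoothOrientation (𝓡 1) M) := by
  classical
  obtain ⟨μ₀⟩ := nonempty_orientation (EuclideanSpace ℝ (Fin 1))
  -- a member of the family at each point
  have hidx : ∀ y : M, ∃ i, y ∈ (g i).source := fun y => by
    have hy : y ∈ ⋃ i, (g i).source := by rw [hcov]; trivial
    simpa only [mem_iUnion] using hy
  choose idx hidx using hidx
  -- coordinates of the preferred charts and the reference chart at each point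
  set c : M → M → ℝ := fun z q => (extChartAt (𝓡 1) z q) 0 with hc
  set ρ : M → M → ℝ := fun y => (g (idx y) : M → ℝ) with hρ
  refine ⟨
    { toFun := fun y =>
        if ∀ᶠ q in 𝓝 y, (c y q < c y y ↔ ρ y q < ρ y y) ∧ (c y y < c y q ↔ ρ y y < ρ y q)
        then μ₀ else -μ₀
      eventually_eq_iff' := fun x => ?_ }⟩
  -- the reference chart `r` at `x` is valid on a whole neighbourhood of `x`
  set r : OpenPartialHomeomorph M ℝ := g (idx x) with hr
  have hxr : x ∈ r.source := hidx x
  have hρr : ∀ᶠ y in 𝓝 x, y ∈ r.source ∧ ∀ u : M → ℝ,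
      ((∀ᶠ q in 𝓝 y, (u q < u y ↔ ρ y q < ρ y y) ∧ (u y < u q ↔ ρ y y < ρ y q)) ↔
        ∀ᶠ q in 𝓝 y, (u q < u y ↔ r q < r y) ∧ (u y < u q ↔ r y < r q)) := by
    filter_upwards [r.open_source.mem_nhds hxr] with y hy
    refine ⟨hy, fun u => ?_⟩
    have hef := hcompat (idx y) (idx x) y ⟨hidx y, hy⟩
    exact ⟨fun h => same_trans h hef, fun h => same_trans h (same_symm hef)⟩
  -- near `x`, the chart at `x` has constantly the same or the opposite direction as `r`
  obtain ⟨N, hN, hQ⟩ := exists_nhds_same_or_opp r hxr x (mem_extChartAt_source x)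
  filter_upwards [hρr, hN, (isOpen_extChartAt_source (I := 𝓡 1) x).mem_nhds
    (mem_extChartAt_source x)] with y hy hyN hyx
  obtain ⟨hyr, hρy⟩ := hy
  obtain ⟨-, hρx⟩ := hρr.self_of_nhds
  rw [ite_eq_ite_iff_iff, hρy (c y), hρx (c x)]
  -- charts are not locally constant
  have hr_x : ¬∀ᶠ q in 𝓝 x, r q = r x := not_eventually_chart_eq hxr
  have hr_y : ¬∀ᶠ q in 𝓝 y, r q = r y := not_eventually_chart_eq hyr
  have hcy : ¬∀ᶠ q in 𝓝 y, c y q = c y y := not_eventually_coord_eq (mem_extChartAt_source y)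
  -- the chart at `y` and the chart at `x` each have the same or the opposite direction as `r`
  obtain ⟨N', hN', hP⟩ := exists_nhds_same_or_opp r hyr y (mem_extChartAt_source y)
  have hPy := hP.imp (fun h => h y (mem_of_mem_nhds hN')) fun h => h y (mem_of_mem_nhds hN')
  have hQy := hQ.imp (fun h => h y hyN) fun h => h y hyN
  -- the direction of the chart at `x` relative to `r` is the same at `x` and at `y`
  have hconst : (∀ᶠ q in 𝓝 x, (c x q < c x x ↔ r q < r x) ∧ (c x x < c x q ↔ r x < r q)) ↔
      ∀ᶠ q in 𝓝 y, (c x q < c x y ↔ r q < r y) ∧ (c x y < c x q ↔ r y < r q) := by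
    rcases hQ with h | h
    · exact iff_of_true (h x (mem_of_mem_nhds hN)) (h y hyN)
    · exact iff_of_false (fun h' => not_same_and_opp hr_x h' (h x (mem_of_mem_nhds hN)))
        fun h' => not_same_and_opp hr_y h' (h y hyN)
  rw [hconst, same_iff_same_iff hr_y hcy hPy hQy]
  exact same_coord_iff_det_pos hyx

end Family

/-! ### Milnor's maximality argument: a compatible sequence of arc charts covering `M` -/

section Exhaustion

variable {M : Type*} [TopologicalSpace M] [T2Space M] [LocallyConnectedSpace M]
  [ConnectedSpace M] {e f : OpenPartialHomeomorph M ℝ}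

/-- **Absorption step.** If `M` is *not* covered by two arc charts inducing the same local
order on their overlap, then for two overlapping arc charts `e`, `f` there is an arc chart whose
source contains `e.source ∪ f.source` (Milnor's Lemma `union_or_cover` with its second
alternative excluded; if `f.source ⊆ e.source` take `e`). Milnor (1965), Appendix, Lemma
p. 56. [cite: MilnorTDV1965, Appendix (Classifying 1-manifolds), Lemma p. 56] -/
theorem exists_arcChart_superset_union (he : e.target = univ) (hf : f.target = univ)
    (hne : (e.source ∩ f.source).Nonempty)
    (hG : ¬∃ e₁ f₁ : OpenPartialHomeomorph M ℝ, e₁.target = univ ∧ f₁.target = univ ∧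
        e₁.source ∪ f₁.source = univ ∧
        ∀ q ∈ e₁.source ∩ f₁.source, ∀ᶠ r in 𝓝 q,
          (e₁ r < e₁ q ↔ f₁ r < f₁ q) ∧ (e₁ q < e₁ r ↔ f₁ q < f₁ r)) :
    ∃ e' : OpenPartialHomeomorph M ℝ, e'.target = univ ∧ e.source ∪ f.source ⊆ e'.source := by
  by_cases hfe : f.source ⊆ e.source
  · exact ⟨e, he, union_subset Subset.rfl hfe⟩
  rcases union_or_cover he hf hne hfe with ⟨e', he', hsrc⟩ | hR
  · exact ⟨e', he', hsrc.symm.subset⟩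
  · exact absurd hR hG

omit [T2Space M] [LocallyConnectedSpace M] [ConnectedSpace M] in
/-- **The transition between nested arc charts is increasing or decreasing on all of `ℝ`.** If
the source of the arc chart `e` is contained in the source of the real chart `f`, then
`f ∘ e.symm : ℝ → ℝ` is continuous and injective, hence strictly monotone
(`strictMonoOn_or_strictAntiOn_of_continuousOn`). [folklore] -/
theorem strictMono_or_strictAnti_transition (he : e.target = univ)
    (hsub : e.source ⊆ f.source) : StrictMono (f ∘ e.symm) ∨ StrictAnti (f ∘ e.symm) := by
  have hc : ContinuousOn (f ∘ e.symm) univ :=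
    (f.continuousOn.comp (arc_continuous_symm he).continuousOn fun t _ =>
      hsub (arc_symm_mem he t))
  have hi : InjOn (f ∘ e.symm) univ := by
    intro s _ t _ hst
    have h1 : e.symm s = e.symm t := f.injOn (hsub (arc_symm_mem he s))
      (hsub (arc_symm_mem he t)) hst
    rw [← arc_apply_symm he s, ← arc_apply_symm he t, h1]
  rcases strictMonoOn_or_strictAntiOn_of_continuousOn ordConnected_univ hc hi with h | h
  · exact Or.inl fun s t hst => h trivial trivial hst
  · exact Or.inr fun s t hst => h trivial trivial hst

omit [T2Space M] [LocallyConnectedSpace M] [ConnectedSpace M] in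
/-- **Nested arc charts with increasing transition induce the same local order** at every point
of the smaller arc (`eventually_lt_iff_of_strictMonoOn` on `A = ℝ`). [folklore] -/
theorem same_of_strictMono_transition (he : e.target = univ) (hmono : StrictMono (f ∘ e.symm))
    {p : M} (hp : p ∈ e.source) :
    ∀ᶠ q in 𝓝 p, (e q < e p ↔ f q < f p) ∧ (e p < e q ↔ f p < f q) :=
  eventually_lt_iff_of_strictMonoOn (e := e) (c := f) isOpen_univ (by rw [he])
    (hmono.strictMonoOn univ) ⟨e p, trivial, e.left_inv hp⟩

/-- **Milnor's maximality argument, exhaustion form.** Let `M` be a connected Hausdorff second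
countable locally connected space in which every point lies in the source of an arc chart, and
suppose `M` is *not* covered by two arc charts inducing the same local order on their overlap.
Then there is a sequence of arc charts `g 0, g 1, …` with increasing sources covering `M` and
with all transitions `g (n + 1) ∘ (g n).symm` strictly increasing on `ℝ`. Construction: from a
countable cover by arc charts `c 0, c 1, …` (second countability), put `g 0 = c 0` and let
`g (n + 1)` be an arc chart containing `(g n).source ∪ (c k).source`, `k = (Nat.unpair n).1`,
if these overlap (`exists_arcChart_superset_union`), and `g n` itself otherwise, reflected if
necessary to make the transition from `g n` increasing (`strictMono_or_strictAnti_transition`).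
The union of the sources is open, and closed: a boundary point lies in some `c k`, which meets
some `g n₀` and is therefore absorbed at any later stage `n ≥ n₀` with `(Nat.unpair n).1 = k`
(every index recurs, `Nat.unpair_pair`); by connectedness it is all of `M`. This is Milnor's
"maximal parametrization is onto" (1965, Appendix, pp. 56–57) with the maximal arc replaced by
an exhausting sequence of arcs. [cite: MilnorTDV1965, Appendix (Classifying 1-manifolds), Theorem pp. 56–57] -/
theorem exists_arcCharts_nat_of_not_cover [SecondCountableTopology M]
    (harc : ∀ x : M, ∃ e : OpenPartialHomeomorph M ℝ, e.target = univ ∧ x ∈ e.source)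
    (hG : ¬∃ e₁ f₁ : OpenPartialHomeomorph M ℝ, e₁.target = univ ∧ f₁.target = univ ∧
        e₁.source ∪ f₁.source = univ ∧
        ∀ q ∈ e₁.source ∩ f₁.source, ∀ᶠ r in 𝓝 q,
          (e₁ r < e₁ q ↔ f₁ r < f₁ q) ∧ (e₁ q < e₁ r ↔ f₁ q < f₁ r)) :
    ∃ g : ℕ → OpenPartialHomeomorph M ℝ, (∀ n, (g n).target = univ) ∧
      (∀ n, (g n).source ⊆ (g (n + 1)).source) ∧ (⋃ n, (g n).source) = univ ∧
      ∀ n, StrictMono (g (n + 1) ∘ (g n).symm) := by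
  classical
  choose c hc using harc
  -- a countable subcover `c (x k)`, `k : ℕ`
  obtain ⟨x, hx⟩ : ∃ x : ℕ → M, ⋃ k, (c (x k)).source = univ := by
    obtain ⟨T, hTc, hTU⟩ := TopologicalSpace.countable_cover_nhds
      (f := fun y => (c y).source) fun y => (c y).open_source.mem_nhds (hc y).2
    obtain ⟨y₀⟩ : Nonempty M := inferInstance
    have hTne : T.Nonempty := by
      by_contra h
      rw [not_nonempty_iff_eq_empty] at h
      have : (univ : Set M) = ∅ := by rw [← hTU, h]; simp
      exact (Set.univ_nonempty (α := M)).ne_empty this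
    obtain ⟨x, rfl⟩ := hTc.exists_eq_range hTne
    refine ⟨x, ?_⟩
    rw [← hTU, biUnion_range]
  -- the subtype of arc charts
  set A := {e : OpenPartialHomeomorph M ℝ // e.target = univ} with hA
  -- one absorption step with the chart `c (x k)`, transition made increasing
  have hab : ∀ (e : A) (k : ℕ), ∃ e' : A, e.1.source ⊆ e'.1.source ∧
      ((e.1.source ∩ (c (x k)).source).Nonempty → (c (x k)).source ⊆ e'.1.source) ∧
      StrictMono (e'.1 ∘ e.1.symm) := by
    intro e k
    -- an arc chart containing both sources (when they overlap)
    obtain ⟨e₁, he₁, hsub, habs⟩ : ∃ e₁ : OpenPartialHomeomorph M ℝ, e₁.target = univ ∧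
        e.1.source ⊆ e₁.source ∧
        ((e.1.source ∩ (c (x k)).source).Nonempty → (c (x k)).source ⊆ e₁.source) := by
      by_cases hne : (e.1.source ∩ (c (x k)).source).Nonempty
      · obtain ⟨e', he', hsub⟩ := exists_arcChart_superset_union e.2 (hc (x k)).1 hne hG
        exact ⟨e', he', subset_union_left.trans hsub, fun _ => subset_union_right.trans hsub⟩
      · exact ⟨e.1, e.2, Subset.rfl, fun h => absurd h hne⟩
    -- reflect if the transition is decreasing
    rcases strictMono_or_strictAnti_transition e.2 hsub with hm | ha
    · exact ⟨⟨e₁, he₁⟩, hsub, habs, hm⟩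
    · refine ⟨⟨e₁.transHomeomorph (Homeomorph.neg ℝ), neg_chart_target he₁⟩, hsub, habs, ?_⟩
      intro s t hst
      simp only [Function.comp_apply, neg_chart_apply, neg_lt_neg_iff]
      exact ha hst
  choose step hstep_mono hstep_abs hstep_trans using hab
  -- the sequence: `g 0 = c (x 0)`, `g (n + 1) = step (g n) (Nat.unpair n).1`
  let g : ℕ → A := fun n => Nat.rec ⟨c (x 0), (hc (x 0)).1⟩ (fun m acc => step acc (Nat.unpair m).1) n
  have g_zero : g 0 = ⟨c (x 0), (hc (x 0)).1⟩ := rfl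
  have g_succ : ∀ n, g (n + 1) = step (g n) (Nat.unpair n).1 := fun n => rfl
  have g_mono : ∀ n, (g n).1.source ⊆ (g (n + 1)).1.source := fun n => by
    rw [g_succ]; exact hstep_mono _ _
  have g_mono' : Monotone fun n => (g n).1.source := monotone_nat_of_le_succ g_mono
  refine ⟨fun n => (g n).1, fun n => (g n).2, g_mono, ?_, fun n => ?_⟩
  · -- the union of the arcs is open and closed, hence everything
    set U : Set M := ⋃ n, (g n).1.source with hU
    have hUo : IsOpen U := isOpen_iUnion fun n => (g n).1.open_source
    have hUc : IsClosed U := by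
      rw [← closure_subset_iff_isClosed]
      intro p hp
      have hpk : p ∈ ⋃ k, (c (x k)).source := by rw [hx]; trivial
      obtain ⟨k, hk⟩ := mem_iUnion.1 hpk
      -- the chart `c (x k)` through `p` meets some arc `g n₀`
      obtain ⟨q, hqk, hqU⟩ : ((c (x k)).source ∩ U).Nonempty :=
        mem_closure_iff.1 hp _ (c (x k)).open_source hk
      obtain ⟨n₀, hn₀⟩ := mem_iUnion.1 hqU
      -- a later stage processing the index `k`
      set n : ℕ := Nat.pair k n₀ with hn
      have hkn : (Nat.unpair n).1 = k := by rw [hn, Nat.unpair_pair]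
      have hn₀n : n₀ ≤ n := Nat.right_le_pair k n₀
      have hne : ((g n).1.source ∩ (c (x k)).source).Nonempty :=
        ⟨q, g_mono' hn₀n hn₀, hqk⟩
      have habs : (c (x k)).source ⊆ (g (n + 1)).1.source := by
        rw [g_succ, hkn]
        exact hstep_abs (g n) k (hkn ▸ hne)
      exact mem_iUnion.2 ⟨n + 1, habs hk⟩
    have hclopen : IsClopen U := ⟨hUc, hUo⟩
    exact hclopen.eq_univ ⟨x 0, mem_iUnion.2 ⟨0, by rw [g_zero]; exact (hc (x 0)).2⟩⟩
  · -- transitions are increasing by construction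
    change StrictMono ((g (n + 1)).1 ∘ (g n).1.symm)
    rw [g_succ]
    exact hstep_trans _ _

/-- **Every connected Hausdorff second countable `1`-manifold is covered by a compatible
sequence of arc charts** (Milnor's Theorem, topological content, general case: *Topology from
the Differentiable Viewpoint* (1965), Appendix, pp. 55–57 — a maximal parametrization by
arc-length is onto unless `M` is a circle covered by two compatible parametrizations). For a
connected Hausdorff second countable locally connected space in which every point lies in the
source of an arc chart, there are arc charts `g n`, `n : ℕ`, whose sources cover `M` and which
induce pairwise the same local order on overlaps. Proof: either `M` is covered by two compatible
arc charts (the second alternative of Milnor's Lemma `union_or_cover`; take the sequence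
`e, f, f, …`), or the exhaustion `exists_arcCharts_nat_of_not_cover` applies, whose transitions
`g n ∘ (g m).symm`, `m ≤ n`, are increasing as composites of increasing maps, so that `g m` and
`g n` induce the same local order along the smaller arc (`same_of_strictMono_transition`).
[cite: MilnorTDV1965, Appendix (Classifying 1-manifolds), Theorem pp. 56–57] -/
theorem exists_compatible_arcCharts_nat [SecondCountableTopology M]
    (harc : ∀ x : M, ∃ e : OpenPartialHomeomorph M ℝ, e.target = univ ∧ x ∈ e.source) :
    ∃ g : ℕ → OpenPartialHomeomorph M ℝ, (∀ n, (g n).target = univ) ∧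
      (⋃ n, (g n).source) = univ ∧
      ∀ m n, ∀ p ∈ (g m).source ∩ (g n).source, ∀ᶠ q in 𝓝 p,
        (g m q < g m p ↔ g n q < g n p) ∧ (g m p < g m q ↔ g n p < g n q) := by
  have hrefl : ∀ (e : OpenPartialHomeomorph M ℝ) (p : M), ∀ᶠ q in 𝓝 p,
      (e q < e p ↔ e q < e p) ∧ (e p < e q ↔ e p < e q) :=
    fun e p => Eventually.of_forall fun q => ⟨Iff.rfl, Iff.rfl⟩
  by_cases hG : ∃ e₁ f₁ : OpenPartialHomeomorph M ℝ, e₁.target = univ ∧ f₁.target = univ ∧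
      e₁.source ∪ f₁.source = univ ∧
      ∀ q ∈ e₁.source ∩ f₁.source, ∀ᶠ r in 𝓝 q,
        (e₁ r < e₁ q ↔ f₁ r < f₁ q) ∧ (e₁ q < e₁ r ↔ f₁ q < f₁ r)
  · -- two compatible arc charts cover `M`
    obtain ⟨e₁, f₁, he₁, hf₁, hcov, hcompat⟩ := hG
    refine ⟨fun n => Nat.rec e₁ (fun _ _ => f₁) n, fun n => ?_, ?_, fun m n p hp => ?_⟩
    · cases n with
      | zero => exact he₁
      | succ n => exact hf₁
    · apply eq_univ_of_univ_subset
      rw [← hcov]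
      rintro p (hp | hp)
      · exact mem_iUnion.2 ⟨0, hp⟩
      · exact mem_iUnion.2 ⟨1, hp⟩
    · cases m with
      | zero =>
        cases n with
        | zero => exact hrefl e₁ p
        | succ n => exact hcompat p hp
      | succ m =>
        cases n with
        | zero => exact same_symm (hcompat p ⟨hp.2, hp.1⟩)
        | succ n => exact hrefl f₁ p
  · -- exhaustion by arcs with increasing transitions
    obtain ⟨g, hg, hmono, hcov, htrans⟩ := exists_arcCharts_nat_of_not_cover harc hG
    have hmono' : Monotone fun n => (g n).source := monotone_nat_of_le_succ hmono
    -- all transitions `g n ∘ (g m).symm`, `m ≤ n`, are increasing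
    have hchain : ∀ m n, m ≤ n → StrictMono (g n ∘ (g m).symm) := by
      intro m n hmn
      induction hmn with
      | refl =>
        intro s t hst
        simp only [Function.comp_apply, arc_apply_symm (hg m)]
        exact hst
      | @step n hmn ih =>
        have heq : g (n + 1) ∘ (g m).symm = (g (n + 1) ∘ (g n).symm) ∘ (g n ∘ (g m).symm) := by
          ext t
          simp only [Function.comp_apply]
          rw [(g n).left_inv (hmono' hmn (arc_symm_mem (hg m) t))]
        rw [heq]
        exact (htrans n).comp ih
    refine ⟨g, hg, hcov, fun m n p hp => ?_⟩
    rcases le_total m n with hmn | hnm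
    · exact same_of_strictMono_transition (hg m) (hchain m n hmn) hp.1
    · exact same_symm (same_of_strictMono_transition (hg n) (hchain n m hnm) hp.2)

end Exhaustion

/-! ### Every connected `1`-manifold is orientable -/

/-- **Every connected Hausdorff second countable `1`-manifold is orientable.** A connected
Hausdorff second countable `C¹` manifold modelled on `EuclideanSpace ℝ (Fin 1)` admits a
`SmoothOrientation`: it is covered by a compatible sequence of arc charts (the topological
content of Milnor's classification of one-manifolds, `exists_compatible_arcCharts_nat`, arc
charts existing at every point by `exists_arcChart_mem_source`), which orients it
(`nonempty_smoothOrientation_of_compatible_family`). This removes the compactness hypothesis of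
`isOrientable_of_compactSpace_of_connectedSpace`. Milnor, *Topology from the Differentiable
Viewpoint* (1965), Appendix (orientability is implicit in the diffeomorphism with `S¹` or an
interval); Hirsch, *Differential Topology* (1976), Ch. 1 §2, Exercise 6 and §4.4.
[cite: MilnorTDV1965, Appendix (Classifying 1-manifolds), Theorem pp. 56–57] -/
theorem isOrientable_of_connectedSpace {M : Type*} [TopologicalSpace M]
    [ChartedSpace (EuclideanSpace ℝ (Fin 1)) M] [IsManifold (𝓡 1) 1 M] [T2Space M]
    [SecondCountableTopology M] [ConnectedSpace M] : IsOrientable (𝓡 1) M := by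
  haveI : LocallyPathConnectedSpace M :=
    ChartedSpace.locallyPathConnectedSpace (EuclideanSpace ℝ (Fin 1)) M
  obtain ⟨g, -, hcov, hcompat⟩ :=
    exists_compatible_arcCharts_nat (M := M) exists_arcChart_mem_source
  exact nonempty_smoothOrientation_of_compatible_family g hcov hcompat

end OneManifold

end Literature.Topology.FourManifolds
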